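import Summits.BirchSwinnertonDyer.BirchSwinnertonDyer.Theorems.EisensteinPrimesFullDescentOrdinaryKernelRat
import Literature.NumberTheory.EllipticCurves.GreenbergSelmer
import Literature.NumberTheory.EllipticCurves.MazurTorsionGaloisStructureProofs
import Literature.NumberTheory.GaloisRepresentations.DirichletCharacterOfGaloisCharacter
import HarnessLib

/-!
# At `3`: the ordinary kernels in the currency of the assembly of `stub_fullDescentAtThreeOfRed`
# (Theorem A at `3`: the `D₃`-stable level-`9` complement, its uniqueness, the `ε mod 9` action, and
# the non-triviality of `D₃` on `E[9]/K₂`)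

Cell `bsd-eis`, seat `bsd-line-x1-p1-w4` gen 6 (width seat on crux 2 `GoodLatticeBDPValue`,
stmt-BirchSwinnertonDyer-19032, line `halves` v21). ROUTE-FREE helper (`--supports` the crux): brick
**F3d** of the AN-3 Stub B road — the «at 3» glue between the F3 package
(`FullDescentOrdinaryNine.Rat.exists_ordinary_reduction_kernels_of_hasGoodReductionAtPrime`,
`Theorems/EisensteinPrimesFullDescentOrdinaryKernelRat`) and LEAD g5's assembly spec
(`Theorems/EisensteinPrimesFullDescentAssembly`: hypothesis hA over `Q : geomTorsion W 3`, `Γ_ℚ`-action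
through `modNCyclotomicCharacter ℚ 3`; LEAD g5's cut «A-I» `exists_cyclic_nine_of_omega_line` consumes this
file by name) together with w2 g5's splitting lemma F5 (`FullDescentKummerSplitting.exists_stable_complement`
at `c = 3`: a `GreenbergSelmer.decomp v₃`-stable complement `hspl`). Theorem B needs no twin of this (LEAD g5's
p656782 consumed the F3 package directly). THEOREMS ONLY (no definition, no named fact, no `sorry`); nothing here closes a stub or proves a
summit statement.

* `eq_of_stable_of_inf_torsionBy_eq` — abstract uniqueness: in an abelian group with an additive
  operator `f` (an inertia element at `3`), if `K ≤ A[9]` (`#K = 9`, `K ⊓ A[3] = C`, `#C = 3`) satisfies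
  `f x − x ∈ K` on `A[9]` and `f = a •` on `K` with `a ≡ 2 (mod 3)`, then every `f`-stable `B ≤ A[9]` with
  `#B = 9` and `B ⊓ A[3] = C` equals `K`.
* `Rat.exists_kernel_of_omegaLine_atThree` (**F3d-A**, input `hspl` of F5 for Theorem A and steps A3/A5):
  for `Q ∈ E[3] ∖ 0` on which `decomp v` acts through `χ̄₃`, with `C = ⟨Q⟩`: a `decomp v`-stable
  `K₂ ≤ E[9]` with `#K₂ = 9`, `K₂ ⊓ E[3] = C`, `3 • K₂ ≤ C`, inertia trivial on `E[9]/K₂` and acting on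
  `K₂` through `χ̄₉`, **`decomp v` NOT trivial on `E[9]/K₂`**, and **uniqueness**: every `decomp v`-stable
  `B ≤ E[9]` with `#B = 9`, `B ⊓ E[3] = C` is `K₂` (so the `Γ_ℚ`-stable complement returned by F5 IS `K₂`:
  inertia at `3` acts on it by `ε mod 9`, and `Γ_ℚ` cannot act trivially on `E[9]` modulo it).

References: [SerreInventiones1972] §1.11 Prop. 11 and Cor.; w3 g4's memo `AN3-StubB-elementary-road.md`
§2 steps A1–A3 (at 3), A5.
-/

set_option linter.dupNamespace false
set_option autoImplicit false

noncomputable section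

open scoped Classical NNReal NumberField AddSubgroup
open NumberField IsDedekindDomain

namespace Summit.BirchSwinnertonDyer.BirchSwinnertonDyer.Theorems.FullDescentOrdinaryNine

open _root_.WeierstrassCurve Literature.NumberTheory.EllipticCurves
  Literature.NumberTheory.GaloisRepresentations Field IsDedekindDomain.HeightOneSpectrum
  Rat.HeightOneSpectrum Literature.NumberTheory.EllipticCurves.GreenbergSelmer

/-! ## §1 Abstract uniqueness of the level-`9` kernel -/

/-- In an additive group, `a • y = y` with `9 • y = 0` and `a ≡ 2 (mod 3)` forces `y = 0`
(`a − 1` is prime to `9`). [folklore] -/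
theorem eq_zero_of_smul_eq_of_mod_three {A : Type*} [AddCommGroup A] {a : ℕ} (ha : a % 3 = 2) {y : A}
    (h9 : (9 : ℕ) • y = 0) (hy : a • y = y) : y = 0 := by
  have ha1 : 1 ≤ a := by omega
  have h1 : (a - 1) • y = 0 := by
    have h : (a - 1) • y + y = y := by
      conv_rhs => rw [← hy]
      rw [← succ_nsmul, Nat.sub_add_cancel ha1]
    simpa using h
  have hcop : Nat.Coprime (a - 1) 9 := by
    have h3 : ¬ 3 ∣ (a - 1) := by omega
    have : Nat.Coprime (a - 1) 3 := ((Nat.Prime.coprime_iff_not_dvd Nat.prime_three).mpr h3).symm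
    simpa using this.pow_right 2
  have hdvd : addOrderOf y ∣ Nat.gcd (a - 1) 9 :=
    Nat.dvd_gcd (addOrderOf_dvd_iff_nsmul_eq_zero.mpr h1) (addOrderOf_dvd_iff_nsmul_eq_zero.mpr h9)
  rw [hcop, Nat.dvd_one] at hdvd
  exact AddMonoid.addOrderOf_eq_one_iff.mp hdvd

/-- **Uniqueness of the level-`9` kernel.** Let `f` be an additive operator on `A` (an inertia element
at `3`), `C ≤ K` with `#C = 3`, `#K = 9`, such that `f x − x ∈ K` for `x ∈ A[9]`
and `f x = a • x` on `K` with `a ≡ 2 (mod 3)`. Then every `f`-stable `B ≤ A[9]` with `#B = 9` and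
`B ⊓ A[3] = C` equals `K`. Proof: else `B ⊓ K = C`, so `x ↦ f x − x` maps `B` into `C` with kernel of
order `≥ 3`; an `f`-fixed `x ∈ B ∖ 0` has `3x ∈ C ⊆ K` fixed and multiplied by `a`, so `3x = 0`,
`x ∈ B ⊓ A[3] = C ⊆ K`, `x = 0`. [folklore] -/
theorem eq_of_stable_of_inf_torsionBy_eq {A : Type*} [AddCommGroup A] (f : A →+ A)
    {C K B : AddSubgroup A} (hCK : C ≤ K) (hB9 : B ≤ A[(9 : ℕ)])
    (hC : Nat.card C = 3) (hK : Nat.card K = 9) (hB : Nat.card B = 9) (hBC : B ⊓ A[(3 : ℕ)] = C)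
    (hf9 : ∀ x ∈ A[(9 : ℕ)], f x - x ∈ K) {a : ℕ} (ha : a % 3 = 2) (hfK : ∀ x ∈ K, f x = a • x)
    (hfB : ∀ x ∈ B, f x ∈ B) : B = K := by
  haveI : Finite K := Nat.finite_of_card_ne_zero (by rw [hK]; norm_num)
  haveI : Finite B := Nat.finite_of_card_ne_zero (by rw [hB]; norm_num)
  haveI : Finite C := Nat.finite_of_card_ne_zero (by rw [hC]; norm_num)
  have hCB : C ≤ B := hBC ▸ inf_le_left
  -- `D = B ⊓ K` has order `9` or `3`
  set D := B ⊓ K with hD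
  have hCD : C ≤ D := le_inf hCB hCK
  haveI : Finite D := Finite.Set.subset (K : Set A) (fun x hx ↦ (AddSubgroup.mem_inf.mp hx).2)
  have hDdvd : Nat.card D ∣ 9 := hK ▸ AddSubgroup.card_dvd_of_le inf_le_right
  have hCdvd : 3 ∣ Nat.card D := hC ▸ AddSubgroup.card_dvd_of_le hCD
  by_cases hD9 : Nat.card D = 9
  · -- `D = K`, so `K ≤ B`, so `B = K`
    have hDK : D = K := AddSubgroup.eq_of_le_of_card_ge inf_le_right (by rw [hK, hD9])
    have hKB : K ≤ B := hDK ▸ inf_le_left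
    exact (AddSubgroup.eq_of_le_of_card_ge hKB (by rw [hK, hB])).symm
  · exfalso
    have hD3 : Nat.card D = 3 := by
      have h9 : (9 : ℕ) = 3 ^ 2 := by norm_num
      rw [h9, Nat.dvd_prime_pow Nat.prime_three] at hDdvd
      obtain ⟨i, hi, hDi⟩ := hDdvd
      interval_cases i
      · rw [hDi] at hCdvd; norm_num at hCdvd
      · rw [hDi, pow_one]
      · rw [hDi] at hD9; norm_num at hD9
    have hDC : D = C := (AddSubgroup.eq_of_le_of_card_ge hCD (by rw [hC, hD3])).symm
    -- `x ↦ f x - x` maps `B` into `C`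
    have hmapC : ∀ x ∈ B, f x - x ∈ C := fun x hx ↦ by
      rw [← hDC, hD]
      exact AddSubgroup.mem_inf.mpr ⟨sub_mem (hfB x hx) hx, hf9 x (hB9 hx)⟩
    let g : B →+ C :=
      { toFun := fun x ↦ ⟨f x - x, hmapC x x.2⟩
        map_zero' := Subtype.ext (by simp)
        map_add' := fun x y ↦ Subtype.ext (by
          simp only [AddSubgroup.coe_add, map_add, AddMemClass.mk_add_mk]
          abel) }
    -- its kernel has at least `3` elements: pick a non-zero `f`-fixed `x ∈ B`
    have hmul : Nat.card g.ker * Nat.card g.range = 9 := by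
      rw [← AddSubgroup.index_ker, AddSubgroup.card_mul_index, hB]
    have hrange : Nat.card g.range ∣ 3 := hC ▸ AddSubgroup.card_addSubgroup_dvd_card _
    have hker : 1 < Nat.card g.ker := by
      rcases (Nat.dvd_prime Nat.prime_three).mp hrange with h1 | h3
      · rw [h1, mul_one] at hmul; omega
      · rw [h3] at hmul; omega
    haveI : Finite g.ker := Nat.finite_of_card_ne_zero (by omega)
    obtain ⟨⟨x, hxker⟩, ⟨y, hyker⟩, hxy⟩ := Finite.one_lt_card_iff_nontrivial.mp hker
    -- w.l.o.g. a non-zero element of the kernel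
    obtain ⟨z, hzker, hz0⟩ : ∃ z ∈ g.ker, (z : A) ≠ 0 := by
      by_cases hx0 : (x : A) = 0
      · refine ⟨y, hyker, fun hy0 ↦ hxy (Subtype.ext (Subtype.ext (hx0.trans hy0.symm)))⟩
      · exact ⟨x, hxker, hx0⟩
    have hfz : f z = z := by
      have h := congrArg (fun c : C ↦ (c : A)) ((AddMonoidHom.mem_ker).mp hzker)
      exact sub_eq_zero.mp h
    -- `3 • z ∈ C ⊆ K` is fixed by `f` and multiplied by `a`: so `3 • z = 0`
    have hz9 : (9 : ℕ) • (z : A) = 0 := by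
      have := mem_torsionBy_iff.mp (hB9 z.2); rwa [natCast_zsmul] at this
    have h3z : (3 : ℕ) • (z : A) ∈ C := by
      rw [← hBC]
      refine AddSubgroup.mem_inf.mpr ⟨AddSubgroup.nsmul_mem _ z.2 3, mem_torsionBy_iff.mpr ?_⟩
      rw [natCast_zsmul, ← mul_nsmul]
      exact hz9
    have h3z0 : (3 : ℕ) • (z : A) = 0 := by
      refine eq_zero_of_smul_eq_of_mod_three ha ?_ ?_
      · rw [smul_smul, show (9 * 3 : ℕ) = 3 * 9 from rfl, ← smul_smul, hz9, smul_zero]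
      · rw [← hfK _ (hCK h3z), map_nsmul, hfz]
    -- hence `z ∈ B ⊓ A[3] = C ⊆ K`, so `f z = a • z = z` and `z = 0`
    have hzC : (z : A) ∈ C := by
      rw [← hBC]
      exact AddSubgroup.mem_inf.mpr ⟨z.2, mem_torsionBy_iff.mpr (by rw [natCast_zsmul]; exact h3z0)⟩
    have haz : a • (z : A) = z := by rw [← hfK _ (hCK hzC), hfz]
    exact hz0 (eq_zero_of_smul_eq_of_mod_three ha hz9 haz)


/-! ## §2 At the place of `3`, in the assembly currency -/

section AtThree

variable (W : WeierstrassCurve ℚ) [W.IsElliptic] [W.IsGloballyMinimal]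

/-- `(3 : 𝓞 ℚ) ∈ v` for the place `v` with `natGenerator v = 3`. [folklore] -/
theorem natCast_mem_of_natGenerator_eq {v : HeightOneSpectrum (𝓞 ℚ)} {p : ℕ} (hv : natGenerator v = p) :
    (p : 𝓞 ℚ) ∈ v.asIdeal := by
  have h := natCast_natGenerator_mem v
  rwa [hv] at h

/-- The value of `-1 ∈ (ℤ/3)ˣ` as a natural number is `2`. [folklore] -/
theorem val_neg_one_zmod_three : (((-1 : (ZMod 3)ˣ) : ZMod 3)).val = 2 := by decide

/-- `-1 = 2` in `ℤ/3`. [folklore] -/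
theorem coe_neg_one_eq_two_zmod_three : ((-1 : (ZMod 3)ˣ) : ZMod 3) = ((2 : ℕ) : ZMod 3) := by decide

/-- **An inertia element at `3` acting by `−1` on `μ₃` and by `a ≡ 2 (mod 3)` on `μ₉`.** For the place
`v` of `3`: some `τ₀ ∈ I_{ℚ_v}` has `χ̄₃(res τ₀) = −1`, hence `(χ̄₃(res τ₀)).val = 2` and
`(χ̄₉(res τ₀)).val ≡ 2 (mod 3)` (`χ̄₉ ≡ χ̄₃ (mod 3)`, `cast_modNCyclotomicCharacter`).
[cite: SerreLocalFields1979, Ch. IV §4, Prop. 17–18] -/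
theorem Rat.exists_mem_absInertia_val_eq_two {v : HeightOneSpectrum (𝓞 ℚ)} (hv : natGenerator v = 3) :
    ∃ τ₀ ∈ absInertia (v.adicCompletion ℚ),
      ((modNCyclotomicCharacter ℚ 3 (absGaloisRestrict ℚ (v.adicCompletion ℚ) τ₀) : (ZMod 3)ˣ) :
        ZMod 3).val = 2 ∧
      ((modNCyclotomicCharacter ℚ 9 (absGaloisRestrict ℚ (v.adicCompletion ℚ) τ₀) : (ZMod 9)ˣ) :
        ZMod 9).val % 3 = 2 := by
  haveI : Fact (Nat.Prime 3) := ⟨Nat.prime_three⟩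
  obtain ⟨τ₀, hτ₀, h⟩ := Rat.exists_mem_absInertia_modNCyclotomicCharacter_absGaloisRestrict_eq 3 v
    (natCast_mem_of_natGenerator_eq hv) (-1)
  refine ⟨τ₀, hτ₀, by rw [h, val_neg_one_zmod_three], ?_⟩
  have hc := cast_modNCyclotomicCharacter ℚ (show 3 ∣ 9 by norm_num)
    (absGaloisRestrict ℚ (v.adicCompletion ℚ) τ₀)
  rw [h] at hc
  -- `hc : ZMod.cast (χ̄₉ : ZMod 9) = ((-1 : (ZMod 3)ˣ) : ZMod 3)`
  set a : ZMod 9 := ((modNCyclotomicCharacter ℚ 9 (absGaloisRestrict ℚ (v.adicCompletion ℚ) τ₀) :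
    (ZMod 9)ˣ) : ZMod 9) with ha
  have hcast : (ZMod.cast a : ZMod 3) = (a.val : ZMod 3) := by
    rw [ZMod.cast_eq_val]
  rw [hcast] at hc
  have h2 : ((a.val : ℕ) : ZMod 3) = ((2 : ℕ) : ZMod 3) := by
    rw [hc, coe_neg_one_eq_two_zmod_three]
  rw [ZMod.natCast_eq_natCast_iff'] at h2
  simpa using h2

/-- **F3d-A: the level-`9` kernel over the `ω`-line (input `hspl` of the splitting lemma for Theorem A,
with steps A3 and A5 at `3`).** `W/ℚ` globally minimal, good ordinary at `3`, `v` the place of `3`, and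
`Q ∈ E[3] ∖ 0` on which `D_v = GreenbergSelmer.decomp v` acts through `χ̄₃`; put `C = ⟨Q⟩ ≤ E(ℚ̄)`. Then there
is `K₂ ≤ E[9]` with: `C ≤ K₂`, `#K₂ = 9`, `K₂ ⊓ E[3] = C`, `3 • K₂ ≤ C`, `K₂` stable under `D_v`, the inertia
group `I_v = GreenbergSelmer.inertia v` trivial on `E[9]/K₂` and acting on `K₂` through `χ̄₉`, `D_v` NOT trivial
on `E[9]/K₂`, and UNIQUENESS: every `D_v`-stable `B ≤ E[9]` of order `9` with `B ⊓ E[3] = C` is `K₂`. (`K₂`,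
`Λ` are the kernels of reduction on `E[9]`, `E[3]`; `Q ∈ Λ` because `res τ₀ • Q − Q = 2Q − Q ∈ Λ` for an inertia
element with `χ̄₃ = −1`, so `C = Λ`; uniqueness is `eq_of_stable_of_inf_torsionBy_eq` with that `τ₀`, which acts
on `K₂` by `χ̄₉(res τ₀) ≡ 2 (mod 3)`.) [cite: SerreInventiones1972, §1.11 Prop. 11 and Cor.] -/
theorem Rat.exists_kernel_of_omegaLine_atThree (hgood : W.HasGoodReductionAtPrime 3)
    (hord : ¬ ((3 : ℤ) ∣ W.frobeniusTrace 3)) {v : HeightOneSpectrum (𝓞 ℚ)} (hv : natGenerator v = 3)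
    {Q : geomTorsion W ((3 : ℕ) : ℤ)} (hQ0 : Q ≠ 0)
    (hQ : ∀ δ ∈ decomp (K := ℚ) v,
      δ • Q = ((modNCyclotomicCharacter ℚ 3 δ : (ZMod 3)ˣ) : ZMod 3).val • Q) :
    ∃ K₂ : AddSubgroup (geomPoints W),
      (AddSubgroup.zmultiples Q).map (geomTorsion W ((3 : ℕ) : ℤ)).subtype ≤ K₂ ∧
      K₂ ≤ geomTorsion W ((9 : ℕ) : ℤ) ∧ Nat.card K₂ = 9 ∧
      K₂ ⊓ geomTorsion W ((3 : ℕ) : ℤ) = (AddSubgroup.zmultiples Q).map (geomTorsion W ((3 : ℕ) : ℤ)).subtype ∧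
      (∀ x ∈ K₂, (3 : ℤ) • x ∈ (AddSubgroup.zmultiples Q).map (geomTorsion W ((3 : ℕ) : ℤ)).subtype) ∧
      (∀ δ ∈ decomp (K := ℚ) v, ∀ x ∈ K₂, δ • x ∈ K₂) ∧
      (∀ δ ∈ inertia (K := ℚ) v, ∀ x ∈ geomTorsion W ((9 : ℕ) : ℤ), δ • x - x ∈ K₂) ∧
      (∀ δ ∈ inertia (K := ℚ) v, ∀ x ∈ K₂,
        δ • x = ((modNCyclotomicCharacter ℚ 9 δ : (ZMod 9)ˣ) : ZMod 9).val • x) ∧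
      ¬ (∀ δ ∈ decomp (K := ℚ) v, ∀ x ∈ geomTorsion W ((9 : ℕ) : ℤ), δ • x - x ∈ K₂) ∧
      (∀ B : AddSubgroup (geomPoints W), B ≤ geomTorsion W ((9 : ℕ) : ℤ) → Nat.card B = 9 →
        (∀ δ ∈ decomp (K := ℚ) v, ∀ x ∈ B, δ • x ∈ B) →
        B ⊓ geomTorsion W ((3 : ℕ) : ℤ) = (AddSubgroup.zmultiples Q).map (geomTorsion W ((3 : ℕ) : ℤ)).subtype →
        B = K₂) := by
  haveI : Fact (Nat.Prime 3) := ⟨Nat.prime_three⟩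
  have hpv : ((3 : ℕ) : 𝓞 ℚ) ∈ v.asIdeal := natCast_mem_of_natGenerator_eq hv
  obtain ⟨Λ, K₂, h1, h2, h3, h4, h5, h6, h7, h8, h9, h10, h11, h12⟩ :=
    Rat.exists_ordinary_reduction_kernels_of_hasGoodReductionAtPrime W 3 (by norm_num) hgood hord v hpv
  obtain ⟨τ₀, hτ₀, hval, hval9⟩ := Rat.exists_mem_absInertia_val_eq_two hv
  set C : AddSubgroup (geomPoints W) :=
    (AddSubgroup.zmultiples Q).map (geomTorsion W ((3 : ℕ) : ℤ)).subtype with hCdef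
  -- `Q ∈ Λ`: `res τ₀ • Q − Q = 2Q − Q = Q ∈ Λ`
  have hQΛ : ((Q : geomPoints W)) ∈ Λ := by
    have hd := h8 τ₀ hτ₀ (Q : geomPoints W) Q.2
    have hQτ : absGaloisRestrict ℚ (v.adicCompletion ℚ) τ₀ • Q =
        ((modNCyclotomicCharacter ℚ 3 (absGaloisRestrict ℚ (v.adicCompletion ℚ) τ₀) : (ZMod 3)ˣ) :
          ZMod 3).val • Q := hQ _ ⟨τ₀, rfl⟩
    have hQ' := congrArg (fun R : geomTorsion W ((3 : ℕ) : ℤ) ↦ (R : geomPoints W)) hQτ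
    simp only [AddSubgroup.torsionBy.coe_smul] at hQ'
    rw [hQ', hval, two_nsmul, add_sub_cancel_right] at hd
    exact hd
  -- `C = Λ`
  have hC3 : Nat.card C = 3 := by
    rw [hCdef, ← Nat.card_congr ((AddSubgroup.zmultiples Q).equivMapOfInjective _
      (geomTorsion W ((3 : ℕ) : ℤ)).subtype_injective).toEquiv, Nat.card_zmultiples,
      addOrderOf_eq_of_ne_zero W 3 hQ0]
  have hCΛ : C = Λ := by
    haveI : Finite Λ := Nat.finite_of_card_ne_zero (by rw [h2]; norm_num)
    refine AddSubgroup.eq_of_le_of_card_ge ?_ (by rw [h2, hC3])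
    rw [hCdef, AddSubgroup.map_le_iff_le_comap]
    exact AddSubgroup.zmultiples_le_of_mem hQΛ
  -- `E[3²] = E[9]` and `χ̄_{3²} = χ̄₉`
  have h39 : ((3 ^ 2 : ℕ) : ℤ) = ((9 : ℕ) : ℤ) := by norm_num
  rw [h39] at h3 h9 h12
  have h4' : Nat.card K₂ = 9 := h4
  have h10' : ∀ τ ∈ absInertia (v.adicCompletion ℚ), ∀ x ∈ K₂,
      absGaloisRestrict ℚ (v.adicCompletion ℚ) τ • x =
        ((modNCyclotomicCharacter ℚ 9 (absGaloisRestrict ℚ (v.adicCompletion ℚ) τ) : (ZMod 9)ˣ) :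
          ZMod 9).val • x := h10
  have hCK : C ≤ K₂ := by rw [hCΛ, ← h5]; exact inf_le_left
  refine ⟨K₂, hCK, h3, h4', h5.trans hCΛ.symm, ?_, ?_, ?_, ?_, ?_, ?_⟩
  · -- `3 • K₂ ≤ K₂ ⊓ E[3] = C`
    intro x hx
    rw [hCΛ, ← h5]
    refine AddSubgroup.mem_inf.mpr ⟨AddSubgroup.zsmul_mem _ hx 3, mem_torsionBy_iff.mpr ?_⟩
    have h9x : ((9 : ℕ) : ℤ) • x = 0 := mem_torsionBy_iff.mp (h3 hx)
    rw [smul_smul]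
    exact h9x
  · rintro δ ⟨τ, rfl⟩ x hx
    exact h7 τ x hx
  · rintro δ hδ x hx
    obtain ⟨τ, hτ, rfl⟩ := Subgroup.mem_map.mp hδ
    exact h9 τ hτ x hx
  · rintro δ hδ x hx
    obtain ⟨τ, hτ, rfl⟩ := Subgroup.mem_map.mp hδ
    exact h10' τ hτ x hx
  · intro H
    exact h12 fun σ x hx ↦ H _ ⟨σ, rfl⟩ x hx
  · intro B hB9 hBcard hBstab hBC
    exact eq_of_stable_of_inf_torsionBy_eq
      (DistribSMul.toAddMonoidHom (geomPoints W) (absGaloisRestrict ℚ (v.adicCompletion ℚ) τ₀))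
      hCK hB9 hC3 h4' hBcard hBC (fun x hx ↦ h9 τ₀ hτ₀ x hx) hval9 (fun x hx ↦ h10' τ₀ hτ₀ x hx)
      (fun x hx ↦ hBstab _ ⟨τ₀, rfl⟩ x hx)


end AtThree

end Summit.BirchSwinnertonDyer.BirchSwinnertonDyer.Theorems.FullDescentOrdinaryNine

end
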